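import Mathlib.Analysis.Normed.Group.Ultra
import Mathlib.NumberTheory.JacobiSum.Basic
import Mathlib.NumberTheory.Padics.PadicNumbers
import HarnessLib

/-!
# The twisting operator `τ_χ` at conductor `p` on functions `ℚ → ℚ_p` and the SQUEEZE behind census
# relation X4-3 (cell `b2b-bsdres`, census cell, seat `b2b-bsdres-census-ctyper1`, gen 2; support file
# of `Additive/CensusX43ValueModule.lean`, which carries the census item, EVIDENCE and DICTIONARY)

HONEST FRAMING (cell `b2b-bsdres`, run/shared/lean/b2b/bsd-rank1-residual/, verbatim in every
file): the goal of the cell is to DELETE the COMBINATION-SHAPED residual classes of the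
Birch–Swinnerton-Dyer formula for ALL analytic-rank `≤ 1` elliptic curves over `ℚ` — "full BSD
formula for every rank `≤ 1` curve in class `C`" assembled STRICTLY from published theorems — so
that the rank-`≤ 1` remainder becomes exactly the CONSTRUCTION-SHAPED classes, which are TYPED
(missing-input `Prop`s), NOT attempted. This is not "finishing BSD". Census cell: research
instrumentation; census output = EVIDENCE / conjecture items, never a Literature fact; labels /
RESIDUAL-MAP marks UNCHANGED; nothing booked. Theorems only (the operator `τ_χ` is written out
as an explicit finite sum; the main file names it); pure ultrametric algebra, no named fact.

THE SQUEEZE (`exists_forall_norm_le_norm_twist`). `τ_χ g(s) := ∑_{b mod p} χ(b)·g(s + b/p)` for a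
multiplicative character `χ` of `ℤ/p` with values in `ℚ_p`. For `χ ≠ 1` and a `1`-periodic
`Φ : ℚ → ℚ_p` with attained sup norm `m`, which is `U_p`-EIGEN with a UNIT eigenvalue
(`∑_{d mod p} Φ(s + d/p) = ã·Φ(ps)`, `‖ã‖ = 1`), the `χ`-twist of `x := τ_{χ⁻¹}Φ` attains the sup
norm of `x`: `τ_χ τ_{χ⁻¹} = χ(−1)·(p − ∑_d τ_{d/p})` (`twist_twist_inv`; the coefficient of `τ_{d/p}`,
`d ≢ 0`, is the Jacobi sum `J(χ, χ⁻¹) = −χ(−1)`, Mathlib `jacobiSum_nontrivial_inv`), so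
`τ_χ x = −χ(−1)·ã·Φ(p·) + p·χ(−1)·Φ`, and at `s₀ = s₁/p` with `‖Φ(s₁)‖ = m` the two terms have norms
`m` and `≤ m/p` — all triangles are isosceles. Used with `Φ` = the symbol of Delbourgo's newform
`f̃ = f_E ⊗ ε̄` and `x = [·]⁺_{f_E}` (see the main file): the census's "the `ε`-twist loses no
`𝔭`-integrality" is this squeeze. Reference for the twisting operator on modular symbols:
Mazur–Tate–Teitelbaum, Invent. Math. 84 (1986) §I.8 [MazurTateTeitelbaum1986Invent].
-/

noncomputable section

open scoped Classical

namespace Summit.BirchSwinnertonDyer.Rank1Residual.Additive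

namespace CensusX43

/-! ### §1 The twisting operator `τ_χ` at conductor `p` on functions `ℚ → ℚ_p`, and the squeeze -/

section Twist

variable {p : ℕ} [hp : Fact p.Prime]

/- NOTATION of the docstrings: `τ_χ g (s) := ∑_{b : ZMod p} χ(b) · g(s + b.val/p)` — the
twisting operator by a multiplicative character `χ` of `ℤ/p` with values in `ℚ_p` on functions
`g : ℚ → ℚ_p` (think `g(s) = [s]⁺_f` on the path `{∞ → s}`); Mazur–Tate–Teitelbaum 1986 §I.8
(`φ ↦ ∑_b χ(b) φ | [1, b/p; 0, 1]`). It is written out explicitly below (no definition in this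
file); the main file `CensusX43ValueModule.lean` names it `CensusX43.twist`. -/

/-- Values of a multiplicative character of `ℤ/p` in `ℚ_p` have norm `≤ 1` (they are `0` or
`(p−1)`-th roots of unity). -/
theorem norm_apply_le_one (χ : MulChar (ZMod p) ℚ_[p]) (a : ZMod p) : ‖χ a‖ ≤ 1 := by
  by_cases ha : IsUnit a
  · have h1 : (χ a) ^ (p - 1) = 1 := by
      rw [← map_pow, ZMod.pow_card_sub_one_eq_one ha.ne_zero, map_one]
    have h2 : ‖χ a‖ ^ (p - 1) = 1 := by rw [← norm_pow, h1, norm_one]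
    have hp1 : p - 1 ≠ 0 := by have := hp.out.two_le; omega
    exact ((pow_eq_one_iff_of_nonneg (norm_nonneg _) hp1).mp h2).le
  · rw [χ.map_nonunit ha, norm_zero]
    exact zero_le_one

/-- `‖χ(−1)‖ = 1`. -/
theorem norm_apply_neg_one (χ : MulChar (ZMod p) ℚ_[p]) : ‖χ (-1)‖ = 1 := by
  have h1 : χ (-1) * χ (-1) = 1 := by
    rw [← map_mul, neg_mul_neg, one_mul, map_one]
  have h2 : ‖χ (-1)‖ * ‖χ (-1)‖ = 1 := by rw [← norm_mul, h1, norm_one]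
  have h0 : 0 ≤ ‖χ (-1)‖ := norm_nonneg _
  nlinarith [norm_apply_le_one χ (-1)]

/-- The trivial bound: `‖(τ_χ g)(s)‖ ≤ ‖g(s + b/p)‖` for SOME residue `b` (ultrametric inequality,
`‖χ(b)‖ ≤ 1`). -/
theorem exists_norm_twist_le (χ : MulChar (ZMod p) ℚ_[p]) (g : ℚ → ℚ_[p]) (s : ℚ) :
    ∃ b : ZMod p, ‖∑ b : ZMod p, χ b * g (s + (b.val : ℚ) / p)‖ ≤ ‖g (s + (b.val : ℚ) / p)‖ := by
  obtain ⟨b, -, hb⟩ := IsUltrametricDist.exists_norm_finsetSum_le_of_nonempty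
    (Finset.univ_nonempty (α := ZMod p)) (fun b : ZMod p => χ b * g (s + (b.val : ℚ) / p))
  refine ⟨b, hb.trans ?_⟩
  rw [norm_mul]
  exact mul_le_of_le_one_left (norm_nonneg _) (norm_apply_le_one χ b)

/-- If `‖g‖ ≤ C` everywhere then `‖τ_χ g‖ ≤ C` everywhere. -/
theorem norm_twist_le_of_forall_le (χ : MulChar (ZMod p) ℚ_[p]) {g : ℚ → ℚ_[p]} {C : ℝ}
    (hg : ∀ s, ‖g s‖ ≤ C) (s : ℚ) : ‖∑ b : ZMod p, χ b * g (s + (b.val : ℚ) / p)‖ ≤ C := by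
  obtain ⟨b, hb⟩ := exists_norm_twist_le χ g s
  exact hb.trans (hg _)

/-- A `1`-periodic function is `k`-periodic for every natural `k`. -/
theorem periodic_natCast {Φ : ℚ → ℚ_[p]} (hper : ∀ s, Φ (s + 1) = Φ s) (s : ℚ) (k : ℕ) :
    Φ (s + k) = Φ s := by
  induction k with
  | zero => rw [Nat.cast_zero, add_zero]
  | succ k ih => rw [Nat.cast_succ, ← add_assoc, hper, ih]

/-- Carry lemma: `b/p + c/p = (b + c)/p + ⌊(b + c)/p⌋` for residues `b, c` (values in `[0, p)`). -/
theorem val_div_add_val_div (b c : ZMod p) :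
    (b.val : ℚ) / p + (c.val : ℚ) / p =
      ((b + c).val : ℚ) / p + (((b.val + c.val) / p : ℕ) : ℚ) := by
  have hp0 : (p : ℚ) ≠ 0 := Nat.cast_ne_zero.mpr hp.out.ne_zero
  have h : b.val + c.val = (b + c).val + p * ((b.val + c.val) / p) := by
    rw [ZMod.val_add]; exact (Nat.mod_add_div _ _).symm
  have h' : (b.val : ℚ) + c.val = ((b + c).val : ℚ) + p * (((b.val + c.val) / p : ℕ) : ℚ) := by
    exact_mod_cast h
  field_simp
  linarith [h']

/-- **Twisting twice.** For a nontrivial `χ` and a `1`-periodic `Φ`: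
`τ_χ (τ_{χ⁻¹} Φ)(s) = −χ(−1) · ∑_{d mod p} Φ(s + d/p) + p · χ(−1) · Φ(s)` — the coefficient of
`Φ(s + d/p)` is the Jacobi sum `J(χ, χ⁻¹) = −χ(−1)` for `d ≢ 0` (Mathlib `jacobiSum_nontrivial_inv`)
and `(p − 1)·χ(−1)` for `d ≡ 0`. -/
theorem twist_twist_inv (χ : MulChar (ZMod p) ℚ_[p]) (hχ : χ ≠ 1) {Φ : ℚ → ℚ_[p]}
    (hper : ∀ s, Φ (s + 1) = Φ s) (s : ℚ) :
    ∑ b : ZMod p, χ b * (∑ c : ZMod p, χ⁻¹ c * Φ (s + (b.val : ℚ) / p + (c.val : ℚ) / p)) =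
      -χ (-1) * (∑ d : ZMod p, Φ (s + (d.val : ℚ) / p)) + (p : ℚ_[p]) * χ (-1) * Φ s := by
  -- Step 1: expand and use periodicity to combine the two shifts.
  have hshift : ∀ b c : ZMod p,
      Φ (s + (b.val : ℚ) / p + (c.val : ℚ) / p) = Φ (s + ((b + c).val : ℚ) / p) := by
    intro b c
    rw [add_assoc, val_div_add_val_div, ← add_assoc, periodic_natCast hper]
  have h1 : ∑ b : ZMod p, χ b * (∑ c : ZMod p, χ⁻¹ c * Φ (s + (b.val : ℚ) / p + (c.val : ℚ) / p)) =
      ∑ b : ZMod p, ∑ c : ZMod p, χ b * χ⁻¹ c * Φ (s + ((b + c).val : ℚ) / p) := by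
    refine Finset.sum_congr rfl fun b _ => ?_
    rw [Finset.mul_sum]
    refine Finset.sum_congr rfl fun c _ => ?_
    rw [hshift, mul_assoc]
  -- Step 2: reindex `c ↦ d = b + c` and swap the sums.
  have h2 : ∀ b : ZMod p,
      ∑ c : ZMod p, χ b * χ⁻¹ c * Φ (s + ((b + c).val : ℚ) / p) =
        ∑ d : ZMod p, χ b * χ⁻¹ (d - b) * Φ (s + (d.val : ℚ) / p) := by
    intro b
    exact Fintype.sum_equiv (Equiv.addLeft b) _ _ (fun c => by
      simp only [Equiv.coe_addLeft, add_sub_cancel_left])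
  have h3 : ∑ b : ZMod p, χ b * (∑ c : ZMod p, χ⁻¹ c * Φ (s + (b.val : ℚ) / p + (c.val : ℚ) / p)) =
      ∑ d : ZMod p, (∑ b : ZMod p, χ b * χ⁻¹ (d - b)) * Φ (s + (d.val : ℚ) / p) := by
    rw [h1]
    simp_rw [h2]
    rw [Finset.sum_comm]
    refine Finset.sum_congr rfl fun d _ => ?_
    rw [Finset.sum_mul]
  -- Step 3: the convolution coefficients.
  have hcoef : ∀ d : ZMod p, ∑ b : ZMod p, χ b * χ⁻¹ (d - b) =
      -χ (-1) + (if d = 0 then (p : ℚ_[p]) * χ (-1) else 0) := by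
    intro d
    by_cases hd : d = 0
    · subst hd
      rw [if_pos rfl]
      have hinv1 : χ⁻¹ (-1 : ZMod p) = χ (-1) := by
        rw [MulChar.inv_apply', inv_neg_one]
      have hterm : ∀ b : ZMod p, χ b * χ⁻¹ (0 - b) = χ (-1) * (1 : MulChar (ZMod p) ℚ_[p]) b := by
        intro b
        rw [zero_sub, neg_eq_neg_one_mul, map_mul, hinv1, ← mul_inv_cancel χ, MulChar.mul_apply]
        ring
      simp_rw [hterm]
      rw [← Finset.mul_sum, MulChar.sum_one_eq_card_units, ZMod.card_units p,
        Nat.cast_sub hp.out.pos, Nat.cast_one]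
      ring
    · rw [if_neg hd, add_zero]
      have hdU : IsUnit d := isUnit_iff_ne_zero.mpr hd
      have hreidx : ∑ b : ZMod p, χ b * χ⁻¹ (d - b) =
          ∑ x : ZMod p, χ (d * x) * χ⁻¹ (d - d * x) :=
        (Fintype.sum_equiv (Equiv.mulLeft₀ d hd) _ _ (fun x => rfl)).symm
      have hterm : ∀ x : ZMod p, χ (d * x) * χ⁻¹ (d - d * x) =
          (χ d * χ⁻¹ d) * (χ x * χ⁻¹ (1 - x)) := by
        intro x
        rw [show d - d * x = d * (1 - x) by ring, map_mul, map_mul]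
        ring
      have hdd : χ d * χ⁻¹ d = 1 := by
        rw [← MulChar.mul_apply, mul_inv_cancel, MulChar.one_apply hdU]
      rw [hreidx]
      simp_rw [hterm, hdd, one_mul]
      exact jacobiSum_nontrivial_inv hχ
  -- Step 4: assemble.
  rw [h3]
  simp_rw [hcoef, add_mul, Finset.sum_add_distrib]
  congr 1
  · rw [← Finset.mul_sum]
  · rw [Finset.sum_eq_single (0 : ZMod p) (fun d _ hd => by rw [if_neg hd, zero_mul])
      (fun h => absurd (Finset.mem_univ _) h)]
    rw [if_pos rfl, ZMod.val_zero, Nat.cast_zero, zero_div, add_zero]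

/-- **The squeeze.** Let `χ ≠ 1`, and let `Φ : ℚ → ℚ_p` be `1`-periodic, with attained sup norm,
and `U_p`-EIGEN with a UNIT eigenvalue `ã` in the sense `∑_{d mod p} Φ(s + d/p) = ã·Φ(p s)`. If
`x = τ_{χ⁻¹} Φ`, then the `χ`-twist of `x` reaches the sup norm of `x`: some value `(τ_χ x)(s₀)` has
norm `≥ ‖x(s)‖` for every `s`. Proof: `τ_χ x = τ_χ τ_{χ⁻¹} Φ = −χ(−1)·ã·Φ(p·) + p·χ(−1)·Φ`
(`twist_twist_inv`); at `s₀ = s₁/p` with `‖Φ(s₁)‖ = max ‖Φ‖ =: m > 0` the first term has norm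
exactly `m` and the second `≤ m/p < m`, so `‖(τ_χ x)(s₀)‖ = m ≥ ‖x(s)‖` (all triangles are
isosceles); if `m = 0` everything vanishes. -/
theorem exists_forall_norm_le_norm_twist (χ : MulChar (ZMod p) ℚ_[p]) (hχ : χ ≠ 1)
    {Φ x : ℚ → ℚ_[p]} {ã : ℚ_[p]} (hã : ‖ã‖ = 1) (hper : ∀ s, Φ (s + 1) = Φ s)
    (hx : ∀ s, x s = ∑ c : ZMod p, χ⁻¹ c * Φ (s + (c.val : ℚ) / p))
    (hU : ∀ s, ∑ d : ZMod p, Φ (s + (d.val : ℚ) / p) = ã * Φ (p * s))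
    (hmax : ∃ s₁, ∀ s, ‖Φ s‖ ≤ ‖Φ s₁‖) :
    ∃ s₀ : ℚ, ∀ s : ℚ, ‖x s‖ ≤ ‖∑ b : ZMod p, χ b * x (s₀ + (b.val : ℚ) / p)‖ := by
  obtain ⟨s₁, hs₁⟩ := hmax
  have hp0 : (p : ℚ) ≠ 0 := Nat.cast_ne_zero.mpr hp.out.ne_zero
  set m : ℝ := ‖Φ s₁‖ with hm
  -- the bound `‖x s‖ ≤ m`
  have hxle : ∀ s, ‖x s‖ ≤ m := fun s => by
    rw [hx s]
    exact norm_twist_le_of_forall_le χ⁻¹ hs₁ s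
  refine ⟨s₁ / p, fun s => (hxle s).trans ?_⟩
  -- the key identity at `s₀ = s₁ / p`
  have hkey : ∑ b : ZMod p, χ b * x (s₁ / p + (b.val : ℚ) / p) =
      -χ (-1) * (ã * Φ s₁) + (p : ℚ_[p]) * χ (-1) * Φ (s₁ / p) := by
    have h := twist_twist_inv χ hχ hper (s₁ / p)
    rw [hU, mul_div_cancel₀ _ hp0] at h
    simp_rw [hx]
    exact h
  rw [hkey]
  by_cases hm0 : m = 0
  · rw [hm0]; exact norm_nonneg _
  · have hmpos : 0 < m := lt_of_le_of_ne (norm_nonneg _) (Ne.symm hm0)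
    have hA : ‖-χ (-1) * (ã * Φ s₁)‖ = m := by
      rw [norm_mul, norm_neg, norm_apply_neg_one, one_mul, norm_mul, hã, one_mul]
    have hB : ‖(p : ℚ_[p]) * χ (-1) * Φ (s₁ / p)‖ < m := by
      rw [norm_mul, norm_mul, norm_apply_neg_one, mul_one, Padic.norm_p]
      have h1 : ‖Φ (s₁ / p)‖ ≤ m := hs₁ _
      have hp1 : (1 : ℝ) < p := by exact_mod_cast hp.out.one_lt
      have hpinv : (p : ℝ)⁻¹ < 1 := inv_lt_one_of_one_lt₀ hp1
      have hpinv0 : 0 ≤ (p : ℝ)⁻¹ := inv_nonneg.mpr (le_of_lt (lt_trans zero_lt_one hp1))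
      calc (p : ℝ)⁻¹ * ‖Φ (s₁ / p)‖ ≤ (p : ℝ)⁻¹ * m := mul_le_mul_of_nonneg_left h1 hpinv0
        _ < 1 * m := mul_lt_mul_of_pos_right hpinv hmpos
        _ = m := one_mul m
    have hne : ‖-χ (-1) * (ã * Φ s₁)‖ ≠ ‖(p : ℚ_[p]) * χ (-1) * Φ (s₁ / p)‖ := by
      rw [hA]; exact (ne_of_lt hB).symm
    rw [IsUltrametricDist.norm_add_eq_max_of_norm_ne_norm hne, hA]
    exact le_max_left _ _

end Twist

end CensusX43

end Summit.BirchSwinnertonDyer.Rank1Residual.Additive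

end
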